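import Mathlib
import HarnessLib
import Summits.Ventures.LatticeQCDFlow.Scoring.PairAcceptanceVariance
import Summits.Ventures.LatticeQCDFlow.Scoring.UncorrectedFlowBias

/-!
# LatticeQCDFlow / Scoring — concentration of the PRINTED acceptance monitor `acc_est` on `n`
# fresh proposals: off by `(t + s)/(1 − s)` or more only with model probability
# `≤ 4/(n t²) + (1/ESS − 1)/(n s²)`

HONEST FRAMING: exact (Metropolis-corrected) sampling algorithms for lattice gauge theory;
figures of merit are autocorrelation/cost numbers at stated couplings and volumes; no
continuum-physics claim.

Venture `LatticeQCDFlow` (cell pub-lqcd), sub-topic `Scoring`; FANOUT row 3 (`s0-u1-a`, S0-B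
implementation A, GEN-7).  NEW WORK of the cell (Chebyshev twice and a union bound over finite
sums), not a published result; NO definition is introduced.  Closes the item "any sampling-error /
concentration statement for `acc_est`" left open by row 3's `Scoring/AcceptanceMonitorBatch` /
`AcceptanceMonitorUnbiased` (GEN-6), on top of `Scoring/PairAcceptanceVariance` (the numerator:
`Var ≤ 4/n` for every flow) and `Scoring/UncorrectedFlowBias` (`Var_q w = 1/ESS − 1`).

## Setting (finite `X`; target `p ≥ 0`, model `q > 0`, both normalised; `w = p/q`; `n ≥ 2` i.i.d.
## proposals `φ : Fin n → X` under `blockProd (fun _ ↦ q)`; `acc = acc(p, q)`, `e = ESS(p, q)`)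

The trainer's monitor (`latflow.flows_jax` 0.2.1 `imh_acceptance_estimate`) on a batch of
un-normalised weights `W_i = c·w(φ_i)` (`c > 0` unknown) is
`acc_est = Σ_{i≠j} min(W_i, W_j) / ((n − 1)·Σ_i W_i)`.

* `sum_offDiag_eq_sum_erase` — the `offDiag` and the `Σ_i Σ_{j ≠ i}` indexings agree;
* `accMonitor_scale_free` — `acc_est(c·w) = acc_est(w)`: the statement below about normalised
  weights IS a statement about the printed number;
* `accMonitor_eq_ratio` — with normalised weights `acc_est = U / W̄`, `U` the pair-min statistic of
  `Scoring/PairAcceptanceVariance` (mean `acc`, variance `≤ 4/n`) and `W̄ = (Σ_i w_i)/n` the batch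
  mean weight (mean `1`);
* `variance_meanWeight_eq` — `E[(W̄ − 1)²] = (1/ESS − 1)/n` exactly (pairwise uncorrelated
  coordinates); `chebyshev_meanWeight` — `P(|W̄ − 1| ≥ s) ≤ (1/ESS − 1)/(n s²)`;
* `abs_div_sub_lt_of_abs_sub_lt` — deterministic: `|U − a| < t`, `|W̄ − 1| < s < 1`, `0 ≤ a ≤ 1`
  ⇒ `|U/W̄ − a| < (t + s)/(1 − s)`;
* **`accMonitor_concentration`** — for all `t > 0`, `0 < s < 1`: the model probability of
  `|acc_est − acc| ≥ (t + s)/(1 − s)` is at most `4/(n t²) + (1/ESS − 1)/(n s²)`.  The only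
  flow-dependent quantity is the population ESS, entering through the denominator alone; the
  numerator's share `4/(n t²)` is the same for every flow.

Reading (value-free; nothing re-scored): at a checkpoint with `n = 8 192` fresh proposals the
printed acceptance estimate is a CERTIFIED reading of the equilibrium acceptance to within
`(t + s)/(1 − s)` at the stated Chebyshev confidence as soon as the population ESS is bounded below;
e.g. `ESS ≥ 1/2`, `t = s = 0.05`: deviation `< 0.106` except with probability `< 0.25`.  Chebyshev
level only — no exponential tail is claimed (the weights are unbounded).

NOT CLAIMED: any ESS, acceptance or monitor value of ours; a variance formula for the ratio
itself; anything for `n < 2`; exponential concentration.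
-/

namespace Summit.Ventures.LatticeQCDFlow.Scoring

open Finset
open Summit.Ventures.LatticeQCDFlow.Exactness
open Summit.Ventures.LatticeQCDFlow.Theory2

variable {X : Type*} [Fintype X] {n : ℕ}

/-! ### The two indexings of the off-diagonal pair sum; scale-freeness; `acc_est = U / W̄` -/

/-- `Σ_{(i,j) ∈ offDiag} f i j = Σ_i Σ_{j ∈ univ.erase i} f i j`. [folklore] -/
theorem sum_offDiag_eq_sum_erase {ι : Type*} [Fintype ι] [DecidableEq ι] (f : ι → ι → ℝ) :
    ∑ z ∈ (univ : Finset ι).offDiag, f z.1 z.2 = ∑ i, ∑ j ∈ univ.erase i, f i j := by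
  refine sum_finset_product' _ _ _ (fun z => ?_)
  rw [mem_offDiag, mem_erase]
  constructor
  · rintro ⟨h1, h2, h3⟩; exact ⟨h1, Ne.symm h3, h2⟩
  · rintro ⟨h1, h3, h2⟩; exact ⟨h1, h2, Ne.symm h3⟩

/-- **The monitor is scale-free**: evaluated on `W_i = c·w_i` (`c > 0`) it equals its value on
`w_i` — so a statement about normalised weights is a statement about the printed number, whose
weights carry the unknown partition function. [folklore] -/
theorem accMonitor_scale_free (w : Fin n → ℝ) {c : ℝ} (hc : 0 < c) :
    (∑ i, ∑ j ∈ univ.erase i, min (c * w i) (c * w j)) / ((n - 1) * ∑ i, c * w i)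
      = (∑ i, ∑ j ∈ univ.erase i, min (w i) (w j)) / ((n - 1) * ∑ i, w i) := by
  have hmin : ∀ i j, min (c * w i) (c * w j) = c * min (w i) (w j) :=
    fun i j => ((monotone_mul_left_of_nonneg hc.le).map_min).symm
  simp_rw [hmin, ← mul_sum]
  rw [mul_left_comm, mul_div_mul_left _ _ hc.ne']

/-- **`acc_est = U / W̄`** for `n ≥ 1`: the monitor on normalised weights is the pair-min
statistic `U = Σ_{offDiag} min / (n(n−1))` divided by the batch mean weight `W̄ = (Σ_i w_i)/n`
(both sides are `0` on a batch of total weight `0`, by the division convention). [folklore] -/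
theorem accMonitor_eq_ratio (w : Fin n → ℝ) (hn : 1 ≤ n) :
    (∑ i, ∑ j ∈ univ.erase i, min (w i) (w j)) / ((n - 1) * ∑ i, w i)
      = ((∑ z ∈ (univ : Finset (Fin n)).offDiag, min (w z.1) (w z.2)) / (n * (n - 1)))
          / ((∑ i, w i) / n) := by
  rw [sum_offDiag_eq_sum_erase (fun i j => min (w i) (w j))]
  have hn0 : (n : ℝ) ≠ 0 := by
    have : (1 : ℝ) ≤ n := by exact_mod_cast hn
    positivity
  rw [div_div_div_eq, mul_comm (∑ i, ∑ j ∈ univ.erase i, min (w i) (w j)) (n : ℝ),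
    show (n : ℝ) * (n - 1) * ∑ i, w i = n * ((n - 1) * ∑ i, w i) by ring,
    mul_div_mul_left _ _ hn0]

/-! ### The batch mean weight: variance `(1/ESS − 1)/n`, Chebyshev -/

/-- **`E[(W̄ − 1)²] = (1/ESS − 1)/n`** for the mean of `n ≥ 1` i.i.d. normalised weights: the
coordinates are pairwise uncorrelated (two-coordinate product marginal) and each has variance
`Var_q w = 1/ESS − 1` (`model_variance_weight_eq`). [folklore] -/
theorem variance_meanWeight_eq {p q : X → ℝ} (hq : ∀ x, 0 < q x) (hp1 : ∑ x, p x = 1)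
    (hq1 : ∑ x, q x = 1) (hn : 1 ≤ n) :
    ∑ φ : Fin n → X, blockProd (fun _ => q) φ * ((∑ i, weight p q (φ i)) / n - 1) ^ 2
      = ((essFrac p q)⁻¹ - 1) / n := by
  classical
  have hn0 : (n : ℝ) ≠ 0 := by
    have : (1 : ℝ) ≤ n := by exact_mod_cast hn
    positivity
  -- centred coordinates
  set v : X → ℝ := fun x => weight p q x - 1 with hvdef
  have hv0 : ∑ x, q x * v x = 0 := by
    simp_rw [hvdef, mul_sub, mul_one]
    rw [sum_sub_distrib, sum_mul_weight hq hp1, hq1, sub_self]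
  have hv2 : ∑ x, q x * v x ^ 2 = (essFrac p q)⁻¹ - 1 := model_variance_weight_eq hq hp1 hq1
  -- `(Σ w_i / n − 1)² = (Σ_i Σ_j v_i v_j) / n²`
  have hsq : ∀ φ : Fin n → X, ((∑ i, weight p q (φ i)) / n - 1) ^ 2
      = (∑ i, ∑ j, v (φ i) * v (φ j)) / n ^ 2 := by
    intro φ
    have e : (∑ i, weight p q (φ i)) / n - 1 = (∑ i, v (φ i)) / n := by
      simp_rw [hvdef]
      rw [sum_sub_distrib, sum_const, card_univ, Fintype.card_fin, nsmul_eq_mul, mul_one]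
      field_simp
    rw [e, div_pow, sq (∑ i, v (φ i)), sum_mul_sum]
  simp_rw [hsq]
  -- expectation of the double sum: diagonal `n·Var`, off-diagonal `0`
  have hdiag : ∀ i : Fin n, ∑ φ : Fin n → X, blockProd (fun _ => q) φ * (v (φ i) * v (φ i))
      = (essFrac p q)⁻¹ - 1 := by
    intro i
    rw [← hv2, sum_blockProd_mul_apply (fun _ : Fin n => q) (fun _ => hq1) i (fun x => v x * v x)]
    exact sum_congr rfl fun x _ => by ring
  have hoff : ∀ i j : Fin n, i ≠ j →
      ∑ φ : Fin n → X, blockProd (fun _ => q) φ * (v (φ i) * v (φ j)) = 0 := by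
    intro i j hij
    rw [sum_blockProd_mul_apply_mul_apply (fun _ : Fin n => q) (fun _ => hq1) v v hij, hv0,
      zero_mul]
  have hE : ∑ φ : Fin n → X, blockProd (fun _ => q) φ * ((∑ i, ∑ j, v (φ i) * v (φ j)) / n ^ 2)
      = (∑ i : Fin n, ∑ j : Fin n,
          ∑ φ : Fin n → X, blockProd (fun _ => q) φ * (v (φ i) * v (φ j))) / n ^ 2 := by
    have e : ∀ φ : Fin n → X, blockProd (fun _ => q) φ * ((∑ i, ∑ j, v (φ i) * v (φ j)) / n ^ 2)
        = (∑ i, ∑ j, blockProd (fun _ => q) φ * (v (φ i) * v (φ j))) / n ^ 2 := by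
      intro φ
      rw [mul_div_assoc', mul_sum]
      congr 1
      exact sum_congr rfl fun i _ => mul_sum _ _ _
    have e2 : ∑ φ : Fin n → X, ∑ i, ∑ j, blockProd (fun _ => q) φ * (v (φ i) * v (φ j))
        = ∑ i : Fin n, ∑ j : Fin n,
            ∑ φ : Fin n → X, blockProd (fun _ => q) φ * (v (φ i) * v (φ j)) := by
      rw [sum_comm]
      exact sum_congr rfl fun i _ => sum_comm
    calc ∑ φ : Fin n → X, blockProd (fun _ => q) φ * ((∑ i, ∑ j, v (φ i) * v (φ j)) / n ^ 2)
        = ∑ φ : Fin n → X,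
            (∑ i, ∑ j, blockProd (fun _ => q) φ * (v (φ i) * v (φ j))) / n ^ 2 :=
          sum_congr rfl fun φ _ => e φ
      _ = (∑ φ : Fin n → X, ∑ i, ∑ j, blockProd (fun _ => q) φ * (v (φ i) * v (φ j))) / n ^ 2 :=
          (sum_div _ _ _).symm
      _ = _ := by rw [e2]
  rw [hE]
  have hinner : ∀ i : Fin n, ∑ j : Fin n,
      ∑ φ : Fin n → X, blockProd (fun _ => q) φ * (v (φ i) * v (φ j)) = (essFrac p q)⁻¹ - 1 := by
    intro i
    rw [← Finset.add_sum_erase _ _ (mem_univ i), hdiag i]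
    rw [sum_eq_zero (fun j hj => hoff i j (ne_of_mem_erase hj).symm), add_zero]
  simp_rw [hinner]
  rw [sum_const, card_univ, Fintype.card_fin, nsmul_eq_mul, div_eq_div_iff (pow_ne_zero 2 hn0) hn0]
  ring

/-- **Chebyshev for the batch mean weight**: `P(|W̄ − 1| ≥ s) ≤ (1/ESS − 1)/(n s²)`. [folklore] -/
theorem chebyshev_meanWeight {p q : X → ℝ} (hq : ∀ x, 0 < q x) (hp1 : ∑ x, p x = 1)
    (hq1 : ∑ x, q x = 1) (hn : 1 ≤ n) {s : ℝ} (hs : 0 < s) :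
    ∑ φ ∈ (univ : Finset (Fin n → X)).filter
        (fun φ => s ≤ |(∑ i, weight p q (φ i)) / n - 1|), blockProd (fun _ => q) φ
      ≤ ((essFrac p q)⁻¹ - 1) / (n * s ^ 2) := by
  classical
  set D : (Fin n → X) → ℝ := fun φ => (∑ i, weight p q (φ i)) / n - 1 with hDdef
  have hbp : ∀ φ : Fin n → X, 0 ≤ blockProd (fun _ => q) φ :=
    fun φ => (blockProd_pos (fun _ z => hq z) φ).le
  have hs2 : 0 < s ^ 2 := pow_pos hs 2
  have hvar : ∑ φ : Fin n → X, blockProd (fun _ => q) φ * D φ ^ 2 = ((essFrac p q)⁻¹ - 1) / n :=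
    variance_meanWeight_eq hq hp1 hq1 hn
  have hind : ∑ φ ∈ univ.filter (fun φ => s ≤ |D φ|), blockProd (fun _ => q) φ
      ≤ ∑ φ ∈ univ.filter (fun φ => s ≤ |D φ|), blockProd (fun _ => q) φ * (D φ ^ 2 / s ^ 2) := by
    refine sum_le_sum fun φ hφ => ?_
    have hle : s ≤ |D φ| := (mem_filter.mp hφ).2
    have h1 : 1 ≤ D φ ^ 2 / s ^ 2 := by
      rw [le_div_iff₀ hs2, one_mul, ← sq_abs (D φ)]
      exact pow_le_pow_left₀ hs.le hle 2
    calc blockProd (fun _ => q) φ = blockProd (fun _ => q) φ * 1 := (mul_one _).symm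
      _ ≤ blockProd (fun _ => q) φ * (D φ ^ 2 / s ^ 2) := mul_le_mul_of_nonneg_left h1 (hbp φ)
  have hall : ∑ φ ∈ univ.filter (fun φ => s ≤ |D φ|), blockProd (fun _ => q) φ * (D φ ^ 2 / s ^ 2)
      ≤ ∑ φ : Fin n → X, blockProd (fun _ => q) φ * (D φ ^ 2 / s ^ 2) :=
    sum_le_sum_of_subset_of_nonneg (filter_subset _ _)
      (fun φ _ _ => mul_nonneg (hbp φ) (div_nonneg (sq_nonneg _) hs2.le))
  have hscale : ∑ φ : Fin n → X, blockProd (fun _ => q) φ * (D φ ^ 2 / s ^ 2)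
      = (∑ φ : Fin n → X, blockProd (fun _ => q) φ * D φ ^ 2) / s ^ 2 := by
    rw [sum_div]
    exact sum_congr rfl fun φ _ => by ring
  calc _ ≤ _ := hind
    _ ≤ _ := hall
    _ = _ := hscale
    _ = ((essFrac p q)⁻¹ - 1) / n / s ^ 2 := by rw [hvar]
    _ = ((essFrac p q)⁻¹ - 1) / (n * s ^ 2) := by rw [div_div]

/-! ### The ratio: a deterministic step and the union bound -/

/-- Deterministic ratio step: `|U − a| < t`, `|W̄ − 1| < s < 1` and `0 ≤ a ≤ 1` give
`|U / W̄ − a| < (t + s)/(1 − s)`. [folklore] -/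
theorem abs_div_sub_lt_of_abs_sub_lt {U Wb a t s : ℝ} (ha0 : 0 ≤ a) (ha1 : a ≤ 1)
    (hs1 : s < 1) (hU : |U - a| < t) (hW : |Wb - 1| < s) :
    |U / Wb - a| < (t + s) / (1 - s) := by
  have hWpos : 0 < Wb := by
    have := (abs_lt.mp hW).1
    linarith
  have h1s : 0 < 1 - s := by linarith
  have hWge : 1 - s < Wb := by
    have := (abs_lt.mp hW).1
    linarith
  rw [div_sub' hWpos.ne', abs_div, abs_of_pos hWpos, div_lt_div_iff₀ hWpos h1s]
  -- `|U − Wb·a| ≤ |U − a| + a·|Wb − 1|`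
  have hnum : |U - Wb * a| ≤ |U - a| + a * |Wb - 1| := by
    have e : U - Wb * a = (U - a) + a * (1 - Wb) := by ring
    rw [e]
    refine (abs_add_le _ _).trans ?_
    rw [abs_mul, abs_of_nonneg ha0, abs_sub_comm 1 Wb]
  have hUa : |U - a| + a * |Wb - 1| < t + s := by
    have : a * |Wb - 1| ≤ 1 * |Wb - 1| := mul_le_mul_of_nonneg_right ha1 (abs_nonneg _)
    linarith
  calc |U - Wb * a| * (1 - s) ≤ (|U - a| + a * |Wb - 1|) * (1 - s) :=
        mul_le_mul_of_nonneg_right hnum h1s.le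
    _ < (t + s) * (1 - s) := mul_lt_mul_of_pos_right hUa h1s
    _ ≤ (t + s) * Wb := by
        have ht : 0 ≤ t + s := by
          have := abs_nonneg (U - a); have := abs_nonneg (Wb - 1); linarith
        exact mul_le_mul_of_nonneg_left hWge.le ht

/-- **Concentration of the printed acceptance monitor.**  For a normalised target `p ≥ 0`, a
positive normalised model `q`, `n ≥ 2` i.i.d. proposals, any `t > 0` and `0 < s < 1`: the model
probability that the self-normalised monitor
`acc_est = Σ_{i≠j} min(w_i, w_j)/((n − 1)Σ_i w_i)` (equal to the printed one on `c·w` by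
`accMonitor_scale_free`) misses the equilibrium acceptance `acc(p, q)` by `(t + s)/(1 − s)` or
more is at most `4/(n t²) + (1/ESS − 1)/(n s²)` — union of the two Chebyshev events for the
numerator statistic `U` (`Scoring/PairAcceptanceVariance`, variance `≤ 4/n` for every flow) and
the mean weight `W̄` (variance `(1/ESS − 1)/n`); outside both, `abs_div_sub_lt_of_abs_sub_lt`.
[folklore] -/
theorem accMonitor_concentration {p q : X → ℝ} (hp : ∀ x, 0 ≤ p x) (hq : ∀ x, 0 < q x)
    (hp1 : ∑ x, p x = 1) (hq1 : ∑ x, q x = 1) (hn : 2 ≤ n) {t s : ℝ} (ht : 0 < t)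
    (hs : 0 < s) (hs1 : s < 1) :
    ∑ φ ∈ (univ : Finset (Fin n → X)).filter (fun φ => (t + s) / (1 - s) ≤
        |(∑ i, ∑ j ∈ univ.erase i, min (weight p q (φ i)) (weight p q (φ j)))
            / ((n - 1) * ∑ i, weight p q (φ i)) - accRate p q|), blockProd (fun _ => q) φ
      ≤ 4 / (n * t ^ 2) + ((essFrac p q)⁻¹ - 1) / (n * s ^ 2) := by
  classical
  have hn1 : 1 ≤ n := le_trans (by norm_num) hn
  set U : (Fin n → X) → ℝ := fun φ =>
    (∑ z ∈ (univ : Finset (Fin n)).offDiag, min (weight p q (φ z.1)) (weight p q (φ z.2)))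
      / (n * (n - 1)) with hUdef
  set Wb : (Fin n → X) → ℝ := fun φ => (∑ i, weight p q (φ i)) / n with hWbdef
  set BU := (univ : Finset (Fin n → X)).filter (fun φ => t ≤ |U φ - accRate p q|) with hBUdef
  set BW := (univ : Finset (Fin n → X)).filter (fun φ => s ≤ |Wb φ - 1|) with hBWdef
  have hbp : ∀ φ : Fin n → X, 0 ≤ blockProd (fun _ => q) φ :=
    fun φ => (blockProd_pos (fun _ z => hq z) φ).le
  have ha0 : 0 ≤ accRate p q := by
    unfold accRate
    exact sum_nonneg fun x _ => sum_nonneg fun y _ =>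
      le_min (mul_nonneg (hp x) (hq y).le) (mul_nonneg (hp y) (hq x).le)
  have ha1 : accRate p q ≤ 1 :=
    (accRate_le hp1 hq1).trans (sub_le_self _ (Literature.Probability.MarkovChains.tvDist_nonneg _ _))
  -- the bad event is inside the union of the two Chebyshev events
  have hsub : (univ : Finset (Fin n → X)).filter (fun φ => (t + s) / (1 - s) ≤
        |(∑ i, ∑ j ∈ univ.erase i, min (weight p q (φ i)) (weight p q (φ j)))
            / ((n - 1) * ∑ i, weight p q (φ i)) - accRate p q|) ⊆ BU ∪ BW := by
    intro φ hφ
    have hbad := (mem_filter.mp hφ).2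
    rw [accMonitor_eq_ratio (fun i => weight p q (φ i)) hn1] at hbad
    rw [mem_union, hBUdef, hBWdef, mem_filter, mem_filter]
    by_contra hnot
    rw [not_or, not_and, not_and, not_le, not_le] at hnot
    have hU : |U φ - accRate p q| < t := hnot.1 (mem_univ _)
    have hW : |Wb φ - 1| < s := hnot.2 (mem_univ _)
    have hlt := abs_div_sub_lt_of_abs_sub_lt ha0 ha1 hs1 hU hW
    exact absurd hbad (not_le.mpr hlt)
  have hU_cheb : ∑ φ ∈ BU, blockProd (fun _ => q) φ ≤ 4 / (n * t ^ 2) :=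
    chebyshev_pairMin hp hq hp1 hq1 hn ht
  have hW_cheb : ∑ φ ∈ BW, blockProd (fun _ => q) φ ≤ ((essFrac p q)⁻¹ - 1) / (n * s ^ 2) :=
    chebyshev_meanWeight hq hp1 hq1 hn1 hs
  calc _ ≤ ∑ φ ∈ BU ∪ BW, blockProd (fun _ => q) φ :=
        sum_le_sum_of_subset_of_nonneg hsub (fun φ _ _ => hbp φ)
    _ ≤ ∑ φ ∈ BU, blockProd (fun _ => q) φ + ∑ φ ∈ BW, blockProd (fun _ => q) φ := by
        -- union bound for a non-negative summand (the 3-line step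
        -- `Literature.Analysis.Fourier.sum_union_le_of_nonneg`, re-derived locally rather than
        -- importing the Fourier chain into the venture)
        rw [← sum_union_inter]
        have : 0 ≤ ∑ φ ∈ BU ∩ BW, blockProd (fun _ => q) φ := sum_nonneg fun φ _ => hbp φ
        linarith
    _ ≤ 4 / (n * t ^ 2) + ((essFrac p q)⁻¹ - 1) / (n * s ^ 2) := add_le_add hU_cheb hW_cheb

end Summit.Ventures.LatticeQCDFlow.Scoring
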